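import Literature.Computability.AlgebraicComplexity.AndrewsForbes2022Lemma66AllFields
import Literature.Computability.AlgebraicComplexity.AndrewsForbes2022Thm68Proofs
import Literature.Computability.AlgebraicComplexity.AndrewsForbes2022RankCondenser
import Literature.Analysis.TotalPositivity.MultiplyPositiveProofs
import HarnessLib

/-!
# Andrews–Forbes 2022 §8: IPS lower bounds for the rank-condenser system — Theorem 8.3,
# Corollary 8.4, Theorem 8.6 (val-lit t24; source `paper:arxiv-2112.00792`; bib `AndrewsForbes2022`)

Typed literature (D-0014/D-0064), everything PROVED, for

* R. Andrews, M. A. Forbes, *Ideals, determinants, and straightening: proving and using lower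
  bounds for polynomial ideals*, STOC 2022 = arXiv:2112.00792 [`AndrewsForbes2022`], §8
  (p0039:L103–p0041:L19): **Theorem 8.3** (low-depth IPS refutations of the rank-condenser system
  are as border-hard as `det_{Θ(r^{1/3})}`), **Corollary 8.4** (characteristic `0`: unconditional
  lower bound `r^{(log r)^{exp(-O(Δ))}} - O(n^4)` via Lemma 6.6 / Cor. 6.5 [LST21]), **Theorem 8.6**
  (the formula analogue, conditional on border formula lower bounds for `det_n`).

This is the "§8, to be typed on request" residue recorded in `AndrewsForbes2022Applications.lean`;
the rank-condenser preliminaries (Def. 2.11, Lemma 2.12, Lemma 8.2 and its erratum) are the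
companion file `AndrewsForbes2022RankCondenser.lean`.  Locators `pNNNN.txt:Lnn` refer to the chunk
files of `lit read paper:arxiv-2112.00792`.

## The system and the rendering

Variables: the entries of two `n × n` matrices `X`, `Y`, arranged as the `n × 2n` matrix `(X | Y)`
(p0040:L33 "Arranging `X` and `Y` into an `n × 2n` matrix, we have `f(X,Y) ∈ I^det_{n,2n,r}`"):
`RCVars n = Fin n × Fin (n + n)`, `rcX` the left block, `rcY` the right block.  Equations
(`rankCondenserSystem F n r 𝓔`, indexed by `↥𝓔 ⊕ RCSide n`): `det_r(E X Eᵀ) = 0` for `E ∈ 𝓔`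
(`rcDetEqn`), and the side equations `XY - I_n = 0`, `X ∘ X - X = 0`, `Y ∘ Y - Y = 0`
(`rcSideEqns`, Hadamard squares entrywise).  An IPS refutation is the tree's `IsIPSCertificate`
(Def. 2.40, placeholder variables `z` (for `𝓔`), `W, U, V`); "a product-depth-`Δ` circuit of size
`s` computes `C + O(ε)`" is membership of `C` in
`borderClass F (productDepthEdgeClass F((ε)) _ s Δ)` (size = WIRES, the §6 class of record of
`AndrewsForbes2022Applications.lean`), "a formula of size `s`" is `formulaClass` (fan-in-two GATE
count; print counts leaves — the constants below carry the translation).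

## Main statements (all proved; no named facts)

* `rcDetEqn_mem_detIdeal` — `det_r(E X Eᵀ) ∈ I^det_{n,2n,r}` (Cauchy–Binet, p0040:L29–L33; via the
  tree's `Literature.Analysis.TotalPositivity.det_mul_eq_sum_pi`).
* `AndrewsForbes2022_thm_8_3_circuit` (char `0`) / `_circuit_posChar` (char `p`): the CONTENT of
  Thm. 8.3's proof — from an IPS refutation `C` of the system computed up to `O(ε)` by a
  product-depth-`Δ` circuit with `s` wires, a product-depth-`(Δ+1)` circuit with `s + 28 n^4`
  wires computing `det_m + O(ε)` (resp. `det_m^{p^e} + O(ε)` for some `e`) for every `m` with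
  `2 m³ ≤ r` (the tree's constant for Cor. 3.9's `t ≤ O(r^{1/3})`, from IL17's `2t³`-vertex ABP);
  `AndrewsForbes2022_thm_8_3` — **Theorem 8.3 AS PRINTED** (hypothesis: a lower-bound function
  `t(n, Δ)` for border computing `det_n` (char `0`) / all `det_n^{p^k}` (char `p`); conclusion
  `t(m, Δ + 1) ≤ s + 28 n^4` for all `m` with `2m³ ≤ r`, i.e. size `≥ t(Ω(r^{1/3}), Δ+1) - O(n^4)`).
* `AndrewsForbes2022_cor_8_4` — **Corollary 8.4** (char `0`; the `r^{(log r)^{exp(-O(Δ))}}` bound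
  with the universal constant existential and an explicit threshold `r ≥ r₀(Δ)`, exactly the
  quantifier shape of the tree's `AndrewsForbes2022_lemma_6_6`, from which it follows).
* `AndrewsForbes2022_thm_8_6_formula` / `_formula_posChar` / `AndrewsForbes2022_thm_8_6` —
  **Theorem 8.6** (formulas: `t(m) ≤ 32 (s + 1) n³`, i.e. size `≥ Ω(t(Ω(r^{1/3})) / n³)`).

TYPED-VS-PRINTED, disclosed.  (1) The statements are proved for EVERY finite family `𝓔` of
`r × n` matrices: the printed hypotheses "`𝓔` a weak `(r, r(n-r))`-lossless rank condenser with
`|𝓔| ≥ 2r(n-r)+1`" (Thm. 8.3) / "the condenser of Lemma 2.12" (Cor. 8.4, Thm. 8.6) serve in print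
only to make the system unsatisfiable via Lemma 8.2, which is FALSE as printed
(`not_AndrewsForbes2022_lemma_8_2` in the companion file); the theorems quantify over refutations
`C` and hold as printed — vacuously where the printed system happens to be satisfiable (e.g.
`char F = 2`, `n = 2`, `r = 1`, `X = Y =` the transposition) — and the as-printed forms below keep
the printed hypotheses as (unused) binders.  (2) `1 ≤ r ≤ n` is Def. 2.11's ambient `n ≥ r ≥ 1`.
(3) Constants: `O(n^4)` ↦ `28 n^4`, `Ω(r^{1/3})` ↦ every `m` with `2m³ ≤ r`, the formula bound
`Ω(t/n³)` ↦ `t ≤ 32 (s+1) n³` in the tree's gate-count measure.  (4) Proof route = the printed one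
(Lemma 8.1 = `AndrewsForbes2022_lemma_8_1_holds`; Cauchy–Binet; "cor:proj to det" = Thm. 3.8 /
Cor. 3.9 = `AndrewsForbes2022_thm_3_8_holds` / `_posChar_holds` with
`Corollary39.layeredABPComputes_detPoly_cubic`; the substitution `W ↦ XY - I_n, …` costs one
product layer and `O(n³)` wires = `ArithCircuit.compose` with the `ΣΠ` circuits of the side
polynomials) with one simplification: the final affine gate `1 - ·` is absorbed into the top gate
of the depth-three oracle circuit (`DepthThreeOracleComputes.of_one_sub`) instead of being built.

Honest framing: kernel-checked transcription of published (2022) conditional/unconditional IPS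
lower bounds; proof-complexity statements about refuting an unsatisfiable (where it is) system;
VP ≠ VNP is NOT proved and nothing here is progress on it (val-lit t24 g8, 2026-08-27).

## References

* [AndrewsForbes2022] R. Andrews, M. A. Forbes, STOC 2022, doi:10.1145/3519935.3520025,
  arXiv:2112.00792 — §8 Thm. 8.3, Cor. 8.4, Rem. 8.5, Thm. 8.6 (p0039:L103–p0041:L19), with
  Def. 2.40, Lemma 8.1, Thm. 3.8, Cor. 3.9, Lemma 6.6.
* [GrochowPitassi2018] J. A. Grochow, T. Pitassi, J. ACM 65 (2018) (the Ideal Proof System).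
-/

noncomputable section

open MvPolynomial Matrix
open scoped RatFunc LaurentSeries

namespace Literature.Computability.AlgebraicComplexity

universe u v w

/-! ### §8: the rank-condenser system `{det_r(E X Eᵀ) = 0}_E ∪ {XY = I_n, X∘X = X, Y∘Y = Y}` -/

section System

variable (F : Type u) [Field F]

/-- Variables of §8 (Thm. 8.3, Cor. 8.4, Thm. 8.6): the entries of `X` and `Y`, arranged as the
`n × 2n` matrix `(X | Y)` (p0040:L33), i.e. the variables of `I^det_{n,2n,r}` (`detIdeal F n (n+n) r`).
[cite: AndrewsForbes2022, Thm. 8.3 (proof)] -/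
abbrev RCVars (n : ℕ) : Type := Fin n × Fin (n + n)

/-- The matrix `X` of variables (left block of `(X | Y)`). [cite: AndrewsForbes2022, Thm. 8.3] -/
def rcX (n : ℕ) : Matrix (Fin n) (Fin n) (MvPolynomial (RCVars n) F) :=
  Matrix.of fun i j => X (i, Fin.castAdd n j)

/-- The matrix `Y` of variables (right block of `(X | Y)`). [cite: AndrewsForbes2022, Thm. 8.3] -/
def rcY (n : ℕ) : Matrix (Fin n) (Fin n) (MvPolynomial (RCVars n) F) :=
  Matrix.of fun i j => X (i, Fin.natAdd n j)

/-- Index of the side equations: one per entry of `XY - I_n` (`W`), of `X ∘ X - X` (`U`) and of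
`Y ∘ Y - Y` (`V`). [cite: AndrewsForbes2022, Thm. 8.3] -/
abbrev RCSide (n : ℕ) : Type := (Fin n × Fin n) ⊕ ((Fin n × Fin n) ⊕ (Fin n × Fin n))

/-- The equation `det_r(E X Eᵀ) = 0` for `E ∈ F^{r × n}` (p0040:L3). [cite: AndrewsForbes2022, Thm. 8.3] -/
def rcDetEqn (n r : ℕ) (E : Matrix (Fin r) (Fin n) F) : MvPolynomial (RCVars n) F :=
  Matrix.det ((E.map (fun e : F => (C e : MvPolynomial (RCVars n) F))) * rcX F n *
    (Eᵀ.map (fun e : F => (C e : MvPolynomial (RCVars n) F))))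

/-- The side equations `XY - I_n = 0`, `X ∘ X - X = 0`, `Y ∘ Y - Y = 0` (p0040:L4–L6; `∘` the
entrywise product: "Boolean axioms" for the entries). [cite: AndrewsForbes2022, Thm. 8.3] -/
def rcSideEqns (n : ℕ) : RCSide n → MvPolynomial (RCVars n) F
  | Sum.inl ij => (rcX F n * rcY F n - 1) ij.1 ij.2
  | Sum.inr (Sum.inl ij) => rcX F n ij.1 ij.2 * rcX F n ij.1 ij.2 - rcX F n ij.1 ij.2
  | Sum.inr (Sum.inr ij) => rcY F n ij.1 ij.2 * rcY F n ij.1 ij.2 - rcY F n ij.1 ij.2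

/-- **The system of Thm. 8.3 / Cor. 8.4 / Thm. 8.6** for a finite family `𝓔 ⊆ F^{r × n}`:
`det_r(E X Eᵀ) = 0` (`E ∈ 𝓔`), `XY - I_n = 0`, `X ∘ X - X = 0`, `Y ∘ Y - Y = 0`, indexed by
`↥𝓔 ⊕ RCSide n` (placeholders `z⃗` for the first block, `W, U, V` for the others, p0040:L8).
[cite: AndrewsForbes2022, Thm. 8.3] -/
def rankCondenserSystem (n r : ℕ) (𝓔 : Finset (Matrix (Fin r) (Fin n) F)) :
    ↥𝓔 ⊕ RCSide n → MvPolynomial (RCVars n) F :=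
  Sum.elim (fun E => rcDetEqn F n r E.1) (rcSideEqns F n)

/-- The substitution `C ↦ C(X, Y, 0, XY - I_n, X∘X - X, Y∘Y - Y)` of the printed proof
(p0040:L20): variables kept, `z ↦ 0`, `W, U, V ↦` the side polynomials.
[cite: AndrewsForbes2022, Thm. 8.3 (proof)] -/
def rcSubst (n : ℕ) (ι : Type v) : RCVars n ⊕ (ι ⊕ RCSide n) → MvPolynomial (RCVars n) F :=
  Sum.elim X (Sum.elim (fun _ => 0) (rcSideEqns F n))

/-- **`f(X,Y) := 1 - C(X, Y, 0, XY - I_n, X∘X - X, Y∘Y - Y)`** (p0040:L20), the polynomial the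
printed proof extracts from a refutation `C`. [cite: AndrewsForbes2022, Thm. 8.3 (proof)] -/
def rcResidual (n : ℕ) {ι : Type v} (C : MvPolynomial (RCVars n ⊕ (ι ⊕ RCSide n)) F) :
    MvPolynomial (RCVars n) F :=
  1 - MvPolynomial.aeval (rcSubst F n ι) C

variable {F}

/-- `X` is the left block of the generic `n × 2n` matrix. [cite: AndrewsForbes2022, Thm. 8.3 (proof)] -/
theorem rcX_eq_submatrix (n : ℕ) :
    rcX F n = (mvPolynomialX (Fin n) (Fin (n + n)) F).submatrix id (Fin.castAdd n) := by
  ext i j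
  simp [rcX, mvPolynomialX]

end System

/-! ### Cauchy–Binet: `det_r(E X Eᵀ)` lies in the ideal of `r × r` minors (p0040:L29–L33) -/

section CauchyBinet

variable {F : Type u} [Field F]

/-- **Cauchy–Binet membership**: for matrices `A ∈ R^{r × n}`, `B ∈ R^{n' × r}` over
`R = F[X_{n × m}]` and any column selection `c`, `det(A · X_{[n],c} · B)` is an `R`-combination
of `r × r` minors of `X`, hence lies in `I^det_{n,m,r}` ("expanding `det_r(E X Eᵀ)` using the
Cauchy–Binet formula … each polynomial `det_r(E X Eᵀ)` lies in the ideal generated by the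
`r × r` minors of `X`", p0040:L29–L32).  Via the tree's `det_mul_eq_sum_pi` (twice).
[cite: AndrewsForbes2022, Thm. 8.3 (proof)] -/
theorem det_mul_submatrix_mul_mem_detIdeal {n m r n' : ℕ} (c : Fin n' → Fin m)
    (A : Matrix (Fin r) (Fin n) (MvPolynomial (Fin n × Fin m) F))
    (B : Matrix (Fin n') (Fin r) (MvPolynomial (Fin n × Fin m) F)) :
    (A * (mvPolynomialX (Fin n) (Fin m) F).submatrix id c * B).det ∈ detIdeal F n m r := by
  rw [Literature.Analysis.TotalPositivity.det_mul_eq_sum_pi]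
  refine Ideal.sum_mem _ fun γ _ => Ideal.mul_mem_left _ _ ?_
  rw [Matrix.submatrix_mul _ _ id id γ Function.bijective_id, Matrix.submatrix_id_id,
    ← det_transpose, transpose_mul, Literature.Analysis.TotalPositivity.det_mul_eq_sum_pi]
  refine Ideal.sum_mem _ fun ρ _ => Ideal.mul_mem_left _ _ ?_
  rw [← transpose_submatrix, det_transpose]
  exact Ideal.subset_span ⟨ρ, c ∘ γ, rfl⟩

/-- `det_r(E X Eᵀ) ∈ I^det_{n,2n,r}` (the variables `(X | Y)`). [cite: AndrewsForbes2022, Thm. 8.3 (proof)] -/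
theorem rcDetEqn_mem_detIdeal (n r : ℕ) (E : Matrix (Fin r) (Fin n) F) :
    rcDetEqn F n r E ∈ detIdeal F n (n + n) r := by
  rw [rcDetEqn, rcX_eq_submatrix]
  exact det_mul_submatrix_mul_mem_detIdeal _ _ _

/-- The ideal of the equations `det_r(E X Eᵀ)`, `E ∈ 𝓔`, is contained in `I^det_{n,2n,r}`.
[cite: AndrewsForbes2022, Thm. 8.3 (proof)] -/
theorem span_rcDetEqn_le_detIdeal (n r : ℕ) (𝓔 : Finset (Matrix (Fin r) (Fin n) F)) :
    Ideal.span (Set.range fun E : ↥𝓔 => rcDetEqn F n r E.1) ≤ detIdeal F n (n + n) r := by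
  refine Ideal.span_le.mpr ?_
  rintro _ ⟨E, rfl⟩
  exact rcDetEqn_mem_detIdeal n r E.1

end CauchyBinet

/-! ### Lemma 8.1 applied: `f = 1 - C(X,Y,0,XY-I,X∘X-X,Y∘Y-Y)` is a nonzero element of `I^det` -/

section Residual

variable {F : Type} [Field F]

/-- The point `X = Y = I_n` satisfies the side equations ("if we omit the equations
`det_r(E X Eᵀ) = 0` … this system becomes satisfiable (take `X = Y = I_n`)", p0040:L17).
[cite: AndrewsForbes2022, Thm. 8.3 (proof)] -/
theorem rcSideEqns_satisfiable (n : ℕ) :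
    ∃ a : RCVars n → F, ∀ j, MvPolynomial.eval a (rcSideEqns F n j) = 0 := by
  classical
  let a : RCVars n → F := fun v =>
    Fin.addCases (fun j => (1 : Matrix (Fin n) (Fin n) F) v.1 j)
      (fun j => (1 : Matrix (Fin n) (Fin n) F) v.1 j) v.2
  have hX : (MvPolynomial.eval a).mapMatrix (rcX F n) = 1 := by
    ext i j
    simp only [RingHom.mapMatrix_apply, Matrix.map_apply, rcX, Matrix.of_apply, eval_X, a,
      Fin.addCases_left]
  have hY : (MvPolynomial.eval a).mapMatrix (rcY F n) = 1 := by
    ext i j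
    simp only [RingHom.mapMatrix_apply, Matrix.map_apply, rcY, Matrix.of_apply, eval_X, a,
      Fin.addCases_right]
  have hXe : ∀ i j, MvPolynomial.eval a (rcX F n i j) = (1 : Matrix (Fin n) (Fin n) F) i j :=
    fun i j => by simpa using congr_fun (congr_fun hX i) j
  have hYe : ∀ i j, MvPolynomial.eval a (rcY F n i j) = (1 : Matrix (Fin n) (Fin n) F) i j :=
    fun i j => by simpa using congr_fun (congr_fun hY i) j
  refine ⟨a, fun j => ?_⟩
  rcases j with ij | ij | ij
  · have h : (MvPolynomial.eval a).mapMatrix (rcX F n * rcY F n - 1) = 0 := by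
      rw [map_sub, map_mul, hX, hY, map_one, mul_one, sub_self]
    show MvPolynomial.eval a ((rcX F n * rcY F n - 1) ij.1 ij.2) = 0
    have h' := congr_fun (congr_fun h ij.1) ij.2
    rw [RingHom.mapMatrix_apply, Matrix.map_apply] at h'
    simpa using h'
  · simp only [rcSideEqns, map_sub, map_mul, hXe, Matrix.one_apply]
    split_ifs <;> simp
  · simp only [rcSideEqns, map_sub, map_mul, hYe, Matrix.one_apply]
    split_ifs <;> simp

/-- **Lemma 8.1 applied to the rank-condenser system** (p0040:L18–L22, L33): for an IPS refutation
`C`, `f = 1 - C(X, Y, 0, XY - I_n, X∘X - X, Y∘Y - Y)` is a NONZERO element of the ideal generated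
by the `det_r(E X Eᵀ)`, hence of `I^det_{n,2n,r}`.  (`AndrewsForbes2022_lemma_8_1_holds` with the
satisfying point `X = Y = I_n`, and Cauchy–Binet.) [cite: AndrewsForbes2022, Thm. 8.3 (proof)] -/
theorem rcResidual_ne_zero_and_mem_detIdeal {n r : ℕ} (𝓔 : Finset (Matrix (Fin r) (Fin n) F))
    (C : MvPolynomial (RCVars n ⊕ (↥𝓔 ⊕ RCSide n)) F)
    (hC : IsIPSCertificate F (rankCondenserSystem F n r 𝓔) C) :
    rcResidual F n C ≠ 0 ∧ rcResidual F n C ∈ detIdeal F n (n + n) r := by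
  obtain ⟨h0, hmem⟩ := AndrewsForbes2022_lemma_8_1_holds F (RCVars n) ↥𝓔 (RCSide n)
    (fun E : ↥𝓔 => rcDetEqn F n r E.1) (rcSideEqns F n) C hC (rcSideEqns_satisfiable n)
  exact ⟨h0, span_rcDetEqn_le_detIdeal n r 𝓔 hmem⟩

end Residual

/-! ### The substitution step: wires and product-depth of `C(X, Y, 0, XY - I_n, X∘X - X, Y∘Y - Y)` -/

section Substitution

variable {F : Type u} [Field F]

/-- **Border classes of low-depth circuits are closed under substitution of exactly computed
polynomials** (the step "this yields a circuit of size `s + O(n³)` and product-depth `Δ + 1` that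
computes `f(X,Y) + O(ε)`", p0040:L34–L35, made generic): if `Φ = f + O(ε)` has `s` wires and
product-depth `Δ`, and circuits `Q_m` (total wires `≤ T`, product-depth `≤ D`) compute the `G_m`
exactly, then `f(G) + O(ε) = Φ(G)` is computed by `ArithCircuit.compose` with `s + T` wires and
product-depth `Δ + D`. [cite: AndrewsForbes2022, Thm. 8.3 (proof)] -/
theorem bind₁_mem_borderClass_productDepthEdgeClass {M : Type v} {τ : Type w} [Fintype M]
    {s Δ D T : ℕ} {f : MvPolynomial M F}
    (hf : f ∈ borderClass F (productDepthEdgeClass (LaurentSeries F) M s Δ))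
    {G : M → MvPolynomial τ F} (Q : M → ArithCircuit F τ) (hQc : ∀ m, (Q m).eval = G m)
    (hQΔ : ∀ m, (Q m).productDepth ≤ D) (hT : ∑ m, (Q m).edgeSize ≤ T) :
    bind₁ G f ∈ borderClass F (productDepthEdgeClass (LaurentSeries F) τ (s + T) (Δ + D)) := by
  obtain ⟨h, ⟨P, hPh, hPΔ, hPs⟩, hhf⟩ := hf
  set φ : F →+* LaurentSeries F := algebraMap F (LaurentSeries F) with hφ
  have hQ' : ∀ m, ((Q m).map φ).Computes (MvPolynomial.map φ (G m)) := fun m => by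
    rw [ArithCircuit.Computes, ArithCircuit.eval_map_apply, hQc m]
  refine ⟨bind₁ (fun m => MvPolynomial.map φ (G m)) h, ?_, ?_⟩
  · refine ⟨P.compose fun m => (Q m).map φ, hPh.compose_bind₁ hQ', ?_, ?_⟩
    · refine (ArithCircuit.productDepth_compose_le (D := D) (fun m => ?_) P).trans
        (Nat.add_le_add_right hPΔ D)
      rw [ArithCircuit.productDepth_mapCoeff]
      exact hQΔ m
    · rw [ArithCircuit.edgeSize_compose]
      refine Nat.add_le_add hPs ?_
      simpa only [ArithCircuit.edgeSize_mapCoeff] using hT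
  · rw [map_bind₁, ← map_sub]
    exact hhf.bind₁ fun m => PolyOrdGE.map_algebraMap (G m)

/-- An entry of `XY - I_n` has at most `n + 1` monomials. [cite: AndrewsForbes2022, Thm. 8.3 (proof)] -/
theorem card_support_rcSideEqns_inl (n : ℕ) (ij : Fin n × Fin n) :
    (rcSideEqns F n (Sum.inl ij)).support.card ≤ n + 1 := by
  classical
  have hrepr : rcSideEqns F n (Sum.inl ij) =
      (∑ k : Fin n, X (ij.1, Fin.castAdd n k) * X (k, Fin.natAdd n ij.2)) -
        (1 : Matrix (Fin n) (Fin n) (MvPolynomial (RCVars n) F)) ij.1 ij.2 := by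
    simp [rcSideEqns, Matrix.mul_apply, rcX, rcY]
  rw [hrepr]
  refine (Finset.card_le_card (support_sub _ _ _)).trans ((Finset.card_union_le _ _).trans ?_)
  refine Nat.add_le_add ?_ ?_
  · refine (Finset.card_le_card support_sum).trans (Finset.card_biUnion_le.trans ?_)
    calc ∑ k : Fin n, (X (ij.1, Fin.castAdd n k) * X (k, Fin.natAdd n ij.2) :
            MvPolynomial (RCVars n) F).support.card ≤ ∑ _k : Fin n, 1 :=
          Finset.sum_le_sum fun k _ => by
            rw [support_X_mul, Finset.card_map, support_X, Finset.card_singleton]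
      _ = n := by simp
  · rw [Matrix.one_apply]
    split_ifs
    · rw [support_one, Finset.card_singleton]
    · simp

/-- An entry of `XY - I_n` has degree `≤ 2`. [cite: AndrewsForbes2022, Thm. 8.3 (proof)] -/
theorem totalDegree_rcSideEqns_inl (n : ℕ) (ij : Fin n × Fin n) :
    (rcSideEqns F n (Sum.inl ij)).totalDegree ≤ 2 := by
  have hrepr : rcSideEqns F n (Sum.inl ij) =
      (∑ k : Fin n, X (ij.1, Fin.castAdd n k) * X (k, Fin.natAdd n ij.2)) -
        (1 : Matrix (Fin n) (Fin n) (MvPolynomial (RCVars n) F)) ij.1 ij.2 := by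
    simp [rcSideEqns, Matrix.mul_apply, rcX, rcY]
  rw [hrepr]
  refine (totalDegree_sub _ _).trans (max_le ?_ ?_)
  · refine totalDegree_finsetSum_le fun k _ => (totalDegree_mul _ _).trans ?_
    rw [totalDegree_X, totalDegree_X]
  · rw [Matrix.one_apply]
    split_ifs
    · rw [totalDegree_one]; exact Nat.zero_le _
    · rw [totalDegree_zero]; exact Nat.zero_le _

/-- A Boolean axiom `x² - x` has at most `2` monomials and degree `≤ 2`. [cite: AndrewsForbes2022, Thm. 8.3 (proof)] -/
theorem card_support_X_mul_X_sub_X_le {σ : Type v} (a : σ) :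
    (X a * X a - X a : MvPolynomial σ F).support.card ≤ 2 ∧
      (X a * X a - X a : MvPolynomial σ F).totalDegree ≤ 2 := by
  classical
  constructor
  · refine (Finset.card_le_card (support_sub _ _ _)).trans ((Finset.card_union_le _ _).trans ?_)
    rw [support_X_mul, Finset.card_map, support_X, Finset.card_singleton]
  · refine (totalDegree_sub _ _).trans (max_le ?_ ?_)
    · refine (totalDegree_mul _ _).trans ?_
      rw [totalDegree_X]
    · rw [totalDegree_X]; exact one_le_two

/-- **Circuits for the substituted polynomials** ("the coordinates of `XY - I_n`, `X∘X - X`, and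
`Y∘Y - Y` can be computed by a multi-output circuit of size `O(n³)` and product-depth `1`",
p0040:L33–L34): every coordinate of the substitution `(X, Y, 0, XY - I_n, X∘X - X, Y∘Y - Y)` has a
`ΣΠ` circuit of product-depth `≤ 1`, with `≤ 2` wires for a variable, `0` for a placeholder
`z ↦ 0`, `≤ 3(n+1)` for an entry of `XY - I_n`, `≤ 6` for a Boolean axiom; in total
`≤ 3n³ + 19n²` wires (variables `4n²`, `W`-block `n² · 3(n+1)`, `U,V`-blocks `12 n²`; the `z`-block
is free, whatever `|𝓔|`). [cite: AndrewsForbes2022, Thm. 8.3 (proof)] -/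
theorem exists_rcSubst_circuits (n : ℕ) (ι : Type) [Fintype ι] :
    ∃ Q : RCVars n ⊕ (ι ⊕ RCSide n) → ArithCircuit F (RCVars n),
      (∀ m, (Q m).eval = rcSubst F n ι m) ∧ (∀ m, (Q m).productDepth ≤ 1) ∧
        ∑ m, (Q m).edgeSize ≤ 3 * n ^ 3 + 19 * n ^ 2 := by
  classical
  -- one `ΣΠ` circuit per coordinate
  have hQ : ∀ m, ∃ Qm : ArithCircuit F (RCVars n), Qm.eval = rcSubst F n ι m ∧
      Qm.productDepth ≤ 1 ∧
        Qm.edgeSize ≤ (rcSubst F n ι m).support.card * ((rcSubst F n ι m).totalDegree + 1) :=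
    fun m => DepthThreeChasm.exists_sumOfMonomials_circuit _
  choose Q hQc hQΔ hQs using hQ
  refine ⟨Q, hQc, hQΔ, ?_⟩
  -- per-block wire bounds
  have hvar : ∀ v : RCVars n, (Q (Sum.inl v)).edgeSize ≤ 2 := fun v => (hQs _).trans (by
    change (X v : MvPolynomial (RCVars n) F).support.card * ((X v : MvPolynomial _ F).totalDegree + 1) ≤ 2
    rw [support_X, Finset.card_singleton, totalDegree_X])
  have hz : ∀ e : ι, (Q (Sum.inr (Sum.inl e))).edgeSize = 0 := fun e =>
    Nat.eq_zero_of_le_zero ((hQs _).trans (by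
      change (0 : MvPolynomial (RCVars n) F).support.card * _ ≤ 0
      rw [support_zero, Finset.card_empty, zero_mul]))
  have hW : ∀ ij : Fin n × Fin n, (Q (Sum.inr (Sum.inr (Sum.inl ij)))).edgeSize ≤ 3 * (n + 1) :=
    fun ij => (hQs _).trans (by
      change (rcSideEqns F n (Sum.inl ij)).support.card * ((rcSideEqns F n (Sum.inl ij)).totalDegree + 1) ≤ _
      calc _ ≤ (n + 1) * (2 + 1) := Nat.mul_le_mul (card_support_rcSideEqns_inl n ij)
              (Nat.succ_le_succ (totalDegree_rcSideEqns_inl n ij))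
        _ = 3 * (n + 1) := by ring)
  have hU : ∀ ij : Fin n × Fin n, (Q (Sum.inr (Sum.inr (Sum.inr (Sum.inl ij))))).edgeSize ≤ 6 :=
    fun ij => (hQs _).trans (by
      change (rcSideEqns F n (Sum.inr (Sum.inl ij))).support.card *
        ((rcSideEqns F n (Sum.inr (Sum.inl ij))).totalDegree + 1) ≤ _
      obtain ⟨h1, h2⟩ := card_support_X_mul_X_sub_X_le (F := F) (σ := RCVars n) (ij.1, Fin.castAdd n ij.2)
      calc _ ≤ 2 * (2 + 1) := Nat.mul_le_mul h1 (Nat.succ_le_succ h2)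
        _ = 6 := rfl)
  have hV : ∀ ij : Fin n × Fin n, (Q (Sum.inr (Sum.inr (Sum.inr (Sum.inr ij))))).edgeSize ≤ 6 :=
    fun ij => (hQs _).trans (by
      change (rcSideEqns F n (Sum.inr (Sum.inr ij))).support.card *
        ((rcSideEqns F n (Sum.inr (Sum.inr ij))).totalDegree + 1) ≤ _
      obtain ⟨h1, h2⟩ := card_support_X_mul_X_sub_X_le (F := F) (σ := RCVars n) (ij.1, Fin.natAdd n ij.2)
      calc _ ≤ 2 * (2 + 1) := Nat.mul_le_mul h1 (Nat.succ_le_succ h2)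
        _ = 6 := rfl)
  -- summing
  rw [Fintype.sum_sum_type, Fintype.sum_sum_type, Fintype.sum_sum_type, Fintype.sum_sum_type]
  have h1 : ∑ v : RCVars n, (Q (Sum.inl v)).edgeSize ≤ 2 * (n * (n + n)) := by
    refine (Finset.sum_le_sum fun v _ => hvar v).trans ?_
    simp [Finset.card_univ, mul_comm]
  have h2 : ∑ e : ι, (Q (Sum.inr (Sum.inl e))).edgeSize = 0 := Finset.sum_eq_zero fun e _ => hz e
  have h3 : ∑ ij : Fin n × Fin n, (Q (Sum.inr (Sum.inr (Sum.inl ij)))).edgeSize ≤ (n * n) * (3 * (n + 1)) := by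
    refine (Finset.sum_le_sum fun ij _ => hW ij).trans ?_
    simp [Finset.card_univ]
  have h4 : ∑ ij : Fin n × Fin n, (Q (Sum.inr (Sum.inr (Sum.inr (Sum.inl ij))))).edgeSize ≤ (n * n) * 6 := by
    refine (Finset.sum_le_sum fun ij _ => hU ij).trans ?_
    simp [Finset.card_univ]
  have h5 : ∑ ij : Fin n × Fin n, (Q (Sum.inr (Sum.inr (Sum.inr (Sum.inr ij))))).edgeSize ≤ (n * n) * 6 := by
    refine (Finset.sum_le_sum fun ij _ => hV ij).trans ?_
    simp [Finset.card_univ]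
  have : 2 * (n * (n + n)) + (0 + ((n * n) * (3 * (n + 1)) + ((n * n) * 6 + (n * n) * 6))) =
      3 * n ^ 3 + 19 * n ^ 2 := by ring
  omega

/-- **The substitution step of Thm. 8.3**: if a product-depth-`Δ` circuit with `s` wires computes
`C + O(ε)`, then a product-depth-`(Δ+1)` circuit with `s + 3n³ + 19n²` wires computes
`C(X, Y, 0, XY - I_n, X∘X - X, Y∘Y - Y) + O(ε)` (p0040:L33–L35: "size `s + O(n³)` and product-depth
`Δ + 1`"). [cite: AndrewsForbes2022, Thm. 8.3 (proof)] -/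
theorem aeval_rcSubst_mem_borderClass {n : ℕ} {ι : Type} [Fintype ι] {s Δ : ℕ}
    {C : MvPolynomial (RCVars n ⊕ (ι ⊕ RCSide n)) F}
    (hC : C ∈ borderClass F (productDepthEdgeClass (LaurentSeries F) _ s Δ)) :
    MvPolynomial.aeval (rcSubst F n ι) C ∈
      borderClass F (productDepthEdgeClass (LaurentSeries F) (RCVars n)
        (s + (3 * n ^ 3 + 19 * n ^ 2)) (Δ + 1)) := by
  obtain ⟨Q, hQc, hQΔ, hT⟩ := exists_rcSubst_circuits (F := F) n ι
  rw [aeval_eq_bind₁]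
  exact bind₁_mem_borderClass_productDepthEdgeClass hC Q hQc hQΔ hT

end Substitution

/-! ### The depth-three oracle step: absorbing `1 - ·` and feeding all variables -/

section Oracle

variable {F : Type u} [Field F]

/-- **Absorbing the affine gate `1 - ·` into the top gate**: if the depth-three `(1 - h)`-oracle
circuit `u · (1 - h)(a(y), ε^{N+1}) + v` computes `g + O(ε)`, then the `h`-oracle circuit
`(-u) · h(a(y), ε^{N+1}) + (u + v)` does. (Used to avoid building the last gate of
`f = 1 - C(…)`: Cor. 3.9 is applied to `1 - Φ` and realized on `Φ`.)
[cite: AndrewsForbes2022, Thm. 3.8 (first bullet)] -/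
theorem DepthThreeOracleComputes.of_one_sub {σ : Type v} {ι : Type w}
    {h : MvPolynomial σ (LaurentSeries F)} {g : MvPolynomial ι (LaurentSeries F)}
    (H : DepthThreeOracleComputes (1 - h) g) : DepthThreeOracleComputes h g := by
  obtain ⟨N, a, u, v, ha, hord⟩ := H
  refine ⟨N, a, -u, u + v, ha, ?_⟩
  have heq : MvPolynomial.C (algebraMap (RatFunc F) (LaurentSeries F) (-u)) *
        MvPolynomial.aeval
          (fun x => MvPolynomial.map (algebraMap (RatFunc F) (LaurentSeries F)) (a x))
          (MvPolynomial.map (epsPow F N) h) +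
      MvPolynomial.C (algebraMap (RatFunc F) (LaurentSeries F) (u + v)) - g =
    MvPolynomial.C (algebraMap (RatFunc F) (LaurentSeries F) u) *
        MvPolynomial.aeval
          (fun x => MvPolynomial.map (algebraMap (RatFunc F) (LaurentSeries F)) (a x))
          (MvPolynomial.map (epsPow F N) (1 - h)) +
      MvPolynomial.C (algebraMap (RatFunc F) (LaurentSeries F) v) - g := by
    rw [map_sub, map_one, map_sub, map_one, map_neg, map_add, map_neg, map_add]
    ring
  rw [heq]
  exact hord

/-- **The border of small low-depth circuits is closed under the depth-three oracle reductions —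
variant feeding ALL variables** (the wire count of Thm. 8.3's proof: "`Φ` of size `s + O(n⁴)`",
p0040:L36, one bottom affine gate per VARIABLE of `h` rather than per used variable as in
`borderClass_of_depthThreeOracleComputes`): `|σ| · (|ι| + 1) + s + 2` wires, same product-depth.
[cite: AndrewsForbes2022, Thm. 8.3 (proof) with Thm. 3.8 (first bullet)] -/
theorem borderClass_of_depthThreeOracleComputes_card {F : Type} [Field F] {σ ι : Type}
    [Fintype σ] [Fintype ι] [DecidableEq ι] [DecidableEq σ] {s Δ : ℕ}
    {h : MvPolynomial σ (LaurentSeries F)}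
    (hh : h ∈ productDepthEdgeClass (LaurentSeries F) σ s Δ) {g : MvPolynomial ι F}
    (hg : DepthThreeOracleComputes h (MvPolynomial.map (algebraMap F (LaurentSeries F)) g)) :
    g ∈ borderClass F
      (productDepthEdgeClass (LaurentSeries F) ι (Fintype.card σ * (Fintype.card ι + 1) + s + 2) Δ) := by
  classical
  obtain ⟨P, hP, hPΔ, hPs⟩ := hh
  obtain ⟨N, a, u, v, ha, hord⟩ := hg
  have ha' : ∀ x, (MvPolynomial.map (algebraMap (RatFunc F) (LaurentSeries F)) (a x)).totalDegree ≤ 1 :=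
    fun x => (Finset.sup_mono (support_map_subset _ _)).trans (ha x)
  have hU : ∀ g' ∈ (P.map (epsPow F N)).gates, ∀ x, ArithCircuit.Operand.var x ∈ g'.args →
      x ∈ (Finset.univ : Finset σ) := fun _ _ x _ => Finset.mem_univ x
  have hUo : ∀ x, (P.map (epsPow F N)).output = ArithCircuit.Operand.var x →
      x ∈ (Finset.univ : Finset σ) := fun x _ => Finset.mem_univ x
  refine ⟨_, ⟨ArithCircuit.affineComp (Finset.univ : Finset σ)
    (fun x => MvPolynomial.map (algebraMap (RatFunc F) (LaurentSeries F)) (a x)) (P.map (epsPow F N))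
    (algebraMap (RatFunc F) (LaurentSeries F) u) (algebraMap (RatFunc F) (LaurentSeries F) v),
    rfl, ?_, ?_⟩, ?_⟩
  · rw [ArithCircuit.productDepth_affineComp, ArithCircuit.productDepth_mapCoeff]; exact hPΔ
  · rw [ArithCircuit.edgeSize_affineComp, ArithCircuit.edgeSize_mapCoeff, Finset.card_univ]
    omega
  · rw [ArithCircuit.eval_affineComp _ _ ha' _ _ _ hU hUo, ArithCircuit.eval_map_apply, hP]
    exact hord

end Oracle

/-! ### One more sum gate: `1 - P` (needed to place `f = 1 - C(…)` itself in a border class) -/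

namespace ArithCircuit

variable {k : Type u} {σ : Type v}

/-- The circuit `1 - P`: the gates of `P` followed by ONE sum gate `(-1) · out(P) + 1 · 1`
(fan-in `2`, no product). [cite: Burgisser2000, Def. 2.1] -/
def oneSub [CommRing k] (P : ArithCircuit k σ) : ArithCircuit k σ where
  gates := P.gates ++ [Gate.sum [((-1 : k), P.output), ((1 : k), Operand.const 1)]]
  output := Operand.gate P.gates.length

/-- `oneSub P` computes `1 - P`. [cite: Burgisser2000, Def. 2.1] -/
theorem eval_oneSub [CommRing k] (P : ArithCircuit k σ) : P.oneSub.eval = 1 - P.eval := by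
  unfold oneSub ArithCircuit.eval
  rw [Operand.eval_gate, gateValues_append_singleton, List.getD_eq_getElem?_getD,
    List.getElem?_append_right (by rw [gateValues_length]), gateValues_length, Nat.sub_self,
    List.getElem?_cons_zero, Option.getD_some]
  simp only [Gate.eval, List.map_cons, List.map_nil, List.sum_cons, List.sum_nil, add_zero,
    smul_eq_C_mul, Operand.eval, map_neg, map_one]
  ring

/-- `oneSub P` has two more wires. [cite: LimayeSrinivasanTavenas2021, §2] -/
theorem edgeSize_oneSub [CommRing k] (P : ArithCircuit k σ) : P.oneSub.edgeSize = P.edgeSize + 2 := by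
  simp [oneSub, ArithCircuit.edgeSize, List.sum_append, Gate.fanIn, Gate.args]

/-- `oneSub P` has the product-depth of `P` (the new gate is a sum gate).
[cite: LimayeSrinivasanTavenas2021, §2] -/
theorem productDepth_oneSub [CommRing k] (P : ArithCircuit k σ) :
    P.oneSub.productDepth = P.productDepth := by
  unfold productDepth wdepth oneSub
  simp only [Operand.depthIn]
  rw [gateWDepths_append_singleton, List.getD_eq_getElem?_getD,
    List.getElem?_append_right (by rw [gateWDepths_length]), gateWDepths_length, Nat.sub_self,
    List.getElem?_cons_zero, Option.getD_some]
  simp [Gate.isProd, Gate.args, Operand.depthIn]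

end ArithCircuit

/-- The closure of wire-size-`s` product-depth-`Δ` circuits is closed under `q ↦ 1 - q` at the
cost of two wires (`ArithCircuit.oneSub`). [cite: AndrewsForbes2022, Thm. 8.3 (proof)] -/
theorem one_sub_mem_borderClass_productDepthEdgeClass {F : Type u} [Field F] {τ : Type v}
    {s Δ : ℕ} {q : MvPolynomial τ F}
    (hq : q ∈ borderClass F (productDepthEdgeClass (LaurentSeries F) τ s Δ)) :
    1 - q ∈ borderClass F (productDepthEdgeClass (LaurentSeries F) τ (s + 2) Δ) := by
  obtain ⟨h, ⟨P, hPh, hPΔ, hPs⟩, hhq⟩ := hq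
  refine ⟨1 - h, ⟨P.oneSub, ?_, ?_, ?_⟩, ?_⟩
  · rw [ArithCircuit.Computes, ArithCircuit.eval_oneSub, hPh]
  · rw [ArithCircuit.productDepth_oneSub]; exact hPΔ
  · rw [ArithCircuit.edgeSize_oneSub]; omega
  · have : (1 - h) - MvPolynomial.map (algebraMap F (LaurentSeries F)) (1 - q) =
        -(h - MvPolynomial.map (algebraMap F (LaurentSeries F)) q) := by
      rw [map_sub, map_one]; ring
    rw [this]
    exact hhq.neg

/-! ### Theorem 8.3 — low-depth IPS refutations of the rank-condenser system -/

section Theorem83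

variable {F : Type} [Field F]

/-- Constants lie in the closure of every low-depth class (a gateless circuit).
[cite: AndrewsForbes2022, §2.1 (closure of a class)] -/
theorem C_mem_borderClass_productDepthEdgeClass {ι : Type} (c : F) (s Δ : ℕ) :
    (MvPolynomial.C c : MvPolynomial ι F) ∈
      borderClass F (productDepthEdgeClass (LaurentSeries F) ι s Δ) := by
  refine mem_borderClass_of_mem ⟨ArithCircuit.ofConst (algebraMap F (LaurentSeries F) c), ?_, ?_, ?_⟩
  · rw [ArithCircuit.Computes, ArithCircuit.eval_ofConst, map_C]
  · exact Nat.zero_le _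
  · exact Nat.zero_le _

/-- **The common core of Thm. 8.3 / Cor. 8.4** (p0040:L14–L35): from a refutation `C` computed up
to `O(ε)` by a product-depth-`Δ` circuit with `s` wires, the polynomial
`f = 1 - C(X,Y,0,XY-I,X∘X-X,Y∘Y-Y)` is a nonzero element of `I^det_{n,2n,r}`, and some `Φ` with
`1 - Φ = f + O(ε)` is computed by a product-depth-`(Δ+1)` circuit with `s + 3n³ + 19n²` wires.
[cite: AndrewsForbes2022, Thm. 8.3 (proof)] -/
theorem Theorem83.prep {n r : ℕ} (𝓔 : Finset (Matrix (Fin r) (Fin n) F))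
    (C : MvPolynomial (RCVars n ⊕ (↥𝓔 ⊕ RCSide n)) F)
    (hC : IsIPSCertificate F (rankCondenserSystem F n r 𝓔) C) {s Δ : ℕ}
    (hCs : C ∈ borderClass F (productDepthEdgeClass (LaurentSeries F) _ s Δ)) :
    rcResidual F n C ≠ 0 ∧ rcResidual F n C ∈ detIdeal F n (n + n) r ∧
      ∃ Φ : MvPolynomial (RCVars n) (LaurentSeries F),
        Φ ∈ productDepthEdgeClass (LaurentSeries F) (RCVars n) (s + (3 * n ^ 3 + 19 * n ^ 2)) (Δ + 1) ∧
        PolyOrdGE 1 ((1 - Φ) - MvPolynomial.map (algebraMap F (LaurentSeries F)) (rcResidual F n C)) := by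
  obtain ⟨hf0, hfI⟩ := rcResidual_ne_zero_and_mem_detIdeal 𝓔 C hC
  obtain ⟨Φ, hΦ, hord⟩ := aeval_rcSubst_mem_borderClass (ι := ↥𝓔) hCs
  refine ⟨hf0, hfI, Φ, hΦ, ?_⟩
  have : (1 - Φ) - MvPolynomial.map (algebraMap F (LaurentSeries F)) (rcResidual F n C) =
      -(Φ - MvPolynomial.map (algebraMap F (LaurentSeries F))
        (MvPolynomial.aeval (rcSubst F n ↥𝓔) C)) := by
    rw [rcResidual, map_sub, map_one]; ring
  rw [this]
  exact hord.neg

/-- The wire count of Thm. 8.3: `|RCVars n| (m² + 1) + (s + 3n³ + 19n²) + 2 ≤ s + 28 n⁴` for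
`1 ≤ r ≤ n` and `2m³ ≤ r` (so `m ≤ n`). [cite: AndrewsForbes2022, Thm. 8.3 (proof)] -/
theorem Theorem83.wires_le {n r m s : ℕ} (hr : 1 ≤ r) (hrn : r ≤ n) (hm : 2 * m ^ 3 ≤ r) :
    n * (n + n) * (m * m + 1) + (s + (3 * n ^ 3 + 19 * n ^ 2)) + 2 ≤ s + 28 * n ^ 4 := by
  have hn1 : 1 ≤ n := hr.trans hrn
  have hmn : m ≤ n := by
    have : m ≤ m ^ 3 := Nat.le_self_pow (by norm_num) m
    omega
  have h1 : m * m ≤ n * n := Nat.mul_le_mul hmn hmn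
  have h2 : n ^ 2 ≤ n ^ 4 := Nat.pow_le_pow_right hn1 (by norm_num)
  have h3 : n ^ 3 ≤ n ^ 4 := Nat.pow_le_pow_right hn1 (by norm_num)
  have h4 : 1 ≤ n ^ 4 := Nat.one_le_pow _ _ hn1
  have h5 : n * (n + n) * (m * m + 1) ≤ 2 * n ^ 4 + 2 * n ^ 2 :=
    calc n * (n + n) * (m * m + 1) ≤ n * (n + n) * (n * n + 1) := Nat.mul_le_mul_left _ (by omega)
      _ = 2 * n ^ 4 + 2 * n ^ 2 := by ring
  linarith

/-- **Thm. 8.3, the reduction (characteristic `0`)**: let `C` be an IPS refutation of the system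
`{det_r(E X Eᵀ) = 0}_{E ∈ 𝓔} ∪ {XY - I_n = 0, X∘X - X = 0, Y∘Y - Y = 0}` (`1 ≤ r ≤ n`, any finite
`𝓔 ⊆ F^{r × n}`). If a product-depth-`Δ` circuit with `s` wires computes `C + O(ε)`, then for every
`m` with `2m³ ≤ r` a product-depth-`(Δ+1)` circuit with `≤ s + 28 n⁴` wires computes
`det_m + O(ε)` (proof of Thm. 8.3, p0040:L14–L42: Lemma 8.1, Cauchy–Binet, substitution, Cor. 3.9).
[cite: AndrewsForbes2022, Thm. 8.3 (proof)] -/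
theorem AndrewsForbes2022_thm_8_3_circuit (F : Type) [Field F] [CharZero F] {n r : ℕ}
    (hr : 1 ≤ r) (hrn : r ≤ n) (𝓔 : Finset (Matrix (Fin r) (Fin n) F))
    (C : MvPolynomial (RCVars n ⊕ (↥𝓔 ⊕ RCSide n)) F)
    (hC : IsIPSCertificate F (rankCondenserSystem F n r 𝓔) C) {s Δ : ℕ}
    (hCs : C ∈ borderClass F (productDepthEdgeClass (LaurentSeries F) _ s Δ))
    {m : ℕ} (hm : 2 * m ^ 3 ≤ r) :
    detPoly (Fin m) F ∈ borderClass F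
      (productDepthEdgeClass (LaurentSeries F) (Fin m × Fin m) (s + 28 * n ^ 4) (Δ + 1)) := by
  classical
  obtain ⟨hf0, hfI, Φ, hΦ, hord⟩ := Theorem83.prep 𝓔 C hC hCs
  rcases Nat.eq_zero_or_pos m with rfl | hmpos
  · have h1 : detPoly (Fin 0) F = MvPolynomial.C 1 := by simp [detPoly]
    rw [h1]
    exact C_mem_borderClass_productDepthEdgeClass _ _ _
  · have habp : InLayeredABPBorder r (detPoly (Fin m) F) :=
      InLayeredABPBorder.of_computes
        ((Corollary39.layeredABPComputes_detPoly_cubic m hmpos).mono hm)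
    have h38 := AndrewsForbes2022_thm_3_8_holds F n (n + n) r (rcResidual F n C) hfI hf0 (1 - Φ)
      hord (Fin m × Fin m) (detPoly (Fin m) F) habp
    have hmem := borderClass_of_depthThreeOracleComputes_card hΦ h38.of_one_sub
    refine borderClass_mono (productDepthEdgeClass_mono _ _ ?_ _) hmem
    simp only [Fintype.card_prod, Fintype.card_fin]
    exact Theorem83.wires_le hr hrn hm

/-- **Thm. 8.3, the reduction (characteristic `p > 0`)**: as `AndrewsForbes2022_thm_8_3_circuit`,
the product-depth-`(Δ+1)` circuit with `≤ s + 28 n⁴` wires computing `det_m^{p^e} + O(ε)` for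
some `e` (Thm. 3.8, third bullet, via `AndrewsForbes2022_thm_3_8_posChar_holds`).
[cite: AndrewsForbes2022, Thm. 8.3 (proof)] -/
theorem AndrewsForbes2022_thm_8_3_circuit_posChar (p : ℕ) [Fact p.Prime] (F : Type) [Field F]
    [CharP F p] {n r : ℕ} (hr : 1 ≤ r) (hrn : r ≤ n) (𝓔 : Finset (Matrix (Fin r) (Fin n) F))
    (C : MvPolynomial (RCVars n ⊕ (↥𝓔 ⊕ RCSide n)) F)
    (hC : IsIPSCertificate F (rankCondenserSystem F n r 𝓔) C) {s Δ : ℕ}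
    (hCs : C ∈ borderClass F (productDepthEdgeClass (LaurentSeries F) _ s Δ))
    {m : ℕ} (hm : 2 * m ^ 3 ≤ r) :
    ∃ e : ℕ, detPoly (Fin m) F ^ p ^ e ∈ borderClass F
      (productDepthEdgeClass (LaurentSeries F) (Fin m × Fin m) (s + 28 * n ^ 4) (Δ + 1)) := by
  classical
  obtain ⟨hf0, hfI, Φ, hΦ, hord⟩ := Theorem83.prep 𝓔 C hC hCs
  rcases Nat.eq_zero_or_pos m with rfl | hmpos
  · refine ⟨0, ?_⟩
    have h1 : detPoly (Fin 0) F ^ p ^ 0 = MvPolynomial.C 1 := by simp [detPoly]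
    rw [h1]
    exact C_mem_borderClass_productDepthEdgeClass _ _ _
  · have habp : InLayeredABPBorder r (detPoly (Fin m) F) :=
      InLayeredABPBorder.of_computes
        ((Corollary39.layeredABPComputes_detPoly_cubic m hmpos).mono hm)
    obtain ⟨e, h38⟩ := AndrewsForbes2022_thm_3_8_posChar_holds p F n (n + n) r (rcResidual F n C)
      hfI hf0 (1 - Φ) hord (Fin m × Fin m) (detPoly (Fin m) F) habp
    have hmem := borderClass_of_depthThreeOracleComputes_card hΦ h38.of_one_sub
    refine ⟨e, borderClass_mono (productDepthEdgeClass_mono _ _ ?_ _) hmem⟩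
    simp only [Fintype.card_prod, Fintype.card_fin]
    exact Theorem83.wires_le hr hrn hm

/-- **Andrews–Forbes 2022, Theorem 8.3** (p0039:L103–p0040:L12). Let `X, Y` be `n × n` matrices of
variables, `r ≤ n` (`1 ≤ r`: Def. 2.11's ambient `n ≥ r ≥ 1`), `𝓔 ⊆ F^{r × n}` a weak
`(r, r(n-r))`-lossless rank condenser with `|𝓔| ≥ 2r(n-r) + 1`.  Assume: if `char F = 0`, any
product-depth-`Δ` circuit computing `det_n(X) + O(ε)` has size `≥ t(n, Δ)`; if `char F = p > 0`,
any product-depth-`Δ` circuit computing `det_n(X)^{p^k} + O(ε)`, any `k`, has size `≥ t(n, Δ)`.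
Let `C(X,Y,z⃗,W,U,V)` be an IPS refutation of `det_r(E X Eᵀ) = 0 (E ∈ 𝓔)`, `XY - I_n = 0`,
`X∘X - X = 0`, `Y∘Y - Y = 0`.  Then any product-depth-`Δ` circuit computing `C + O(ε)` has size
`≥ t(Ω(r^{1/3}), Δ + 1) - O(n⁴)`.  RENDERING: size = wires (`productDepthEdgeClass`); the conclusion
for EVERY `m` with `2m³ ≤ r` as `t(m, Δ+1) ≤ s + 28 n⁴`; the condenser hypotheses are carried as
printed but are NOT used by the proof (which therefore holds for every finite `𝓔`; cf. the
erratum `not_AndrewsForbes2022_lemma_8_2`: where the printed system is satisfiable the statement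
is vacuous). PROVED (`AndrewsForbes2022_thm_8_3_circuit`, `_circuit_posChar`).
[cite: AndrewsForbes2022, Thm. 8.3] -/
theorem AndrewsForbes2022_thm_8_3 (F : Type) [Field F] {n r : ℕ} (hr : 1 ≤ r) (hrn : r ≤ n)
    (𝓔 : Finset (Matrix (Fin r) (Fin n) F))
    (_h𝓔 : IsWeakLosslessRankCondenser F r (r * (n - r)) 𝓔) (_hcard : 2 * (r * (n - r)) + 1 ≤ 𝓔.card)
    (t : ℕ → ℕ → ℕ)
    (ht0 : ringChar F = 0 → ∀ (m Δ s : ℕ), detPoly (Fin m) F ∈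
      borderClass F (productDepthEdgeClass (LaurentSeries F) (Fin m × Fin m) s Δ) → t m Δ ≤ s)
    (htp : ∀ p : ℕ, p.Prime → ringChar F = p → ∀ (m k Δ s : ℕ), detPoly (Fin m) F ^ p ^ k ∈
      borderClass F (productDepthEdgeClass (LaurentSeries F) (Fin m × Fin m) s Δ) → t m Δ ≤ s)
    (C : MvPolynomial (RCVars n ⊕ (↥𝓔 ⊕ RCSide n)) F)
    (hC : IsIPSCertificate F (rankCondenserSystem F n r 𝓔) C) {s Δ : ℕ}
    (hCs : C ∈ borderClass F (productDepthEdgeClass (LaurentSeries F) _ s Δ))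
    {m : ℕ} (hm : 2 * m ^ 3 ≤ r) : t m (Δ + 1) ≤ s + 28 * n ^ 4 := by
  obtain ⟨p, hp⟩ := CharP.exists F
  rcases CharP.char_is_prime_or_zero F p with hpp | rfl
  · haveI : Fact p.Prime := ⟨hpp⟩
    obtain ⟨e, he⟩ := AndrewsForbes2022_thm_8_3_circuit_posChar p F hr hrn 𝓔 C hC hCs hm
    exact htp p hpp (ringChar.eq F p) m e (Δ + 1) _ he
  · haveI : CharZero F := CharP.charP_to_charZero F
    exact ht0 (ringChar.eq F 0) m (Δ + 1) _
      (AndrewsForbes2022_thm_8_3_circuit F hr hrn 𝓔 C hC hCs hm)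

end Theorem83

/-! ### Corollary 8.4 — the unconditional low-depth IPS lower bound in characteristic zero -/

section Corollary84

/-- **Cor. 8.4 for every finite `𝓔`** (the proof, p0040:L60: Thm. 8.3's reduction combined with
Lemma 6.6 / Cor. 6.5 [LST21a] applied to the nonzero `f ∈ I^det_{n,2n,r}` computed up to `O(ε)`
in product-depth `Δ + 1` with `s + 3n³ + 19n² + 2` wires): there is a universal `c > 0` such that
for every `Δ ≥ 1` there is `r₀` with: for `char F = 0`, `r₀ ≤ r`, `1 ≤ r ≤ n`, every refutation
`C` of the system for any finite `𝓔 ⊆ F^{r × n}`, and every product-depth-`Δ` circuit with `s`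
wires computing `C + O(ε)`, `r^{(log r)^{exp(-cΔ)}} ≤ s + 28 n⁴`.  Quantifier shape (universal
`c`, threshold `r₀` after `Δ`, natural `log`) = that of the tree's `AndrewsForbes2022_lemma_6_6`.
[cite: AndrewsForbes2022, Cor. 8.4] -/
theorem AndrewsForbes2022_cor_8_4_of_finset : ∃ c : ℝ, 0 < c ∧ ∀ Δ : ℕ, 1 ≤ Δ → ∃ r₀ : ℕ,
    ∀ (F : Type) [Field F] [CharZero F] (n r : ℕ), r₀ ≤ r → 1 ≤ r → r ≤ n →
    ∀ (𝓔 : Finset (Matrix (Fin r) (Fin n) F)) (C : MvPolynomial (RCVars n ⊕ (↥𝓔 ⊕ RCSide n)) F),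
      IsIPSCertificate F (rankCondenserSystem F n r 𝓔) C →
    ∀ s : ℕ, C ∈ borderClass F (productDepthEdgeClass (LaurentSeries F) _ s Δ) →
      (r : ℝ) ^ ((Real.log r) ^ Real.exp (-(c * Δ))) ≤ s + 28 * (n : ℝ) ^ 4 := by
  obtain ⟨c, hc, H⟩ := AndrewsForbes2022_lemma_6_6_holds
  refine ⟨2 * c, by positivity, fun Δ hΔ => ?_⟩
  obtain ⟨r₀, hr₀⟩ := H (Δ + 1) (by omega)
  refine ⟨max r₀ 3, fun F _ _ n r hr0 hr hrn 𝓔 C hC s hCs => ?_⟩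
  obtain ⟨hf0, hfI, Φ, hΦ, hord⟩ := Theorem83.prep 𝓔 C hC hCs
  -- `f` itself is border-computed with two more wires
  have hfmem : rcResidual F n C ∈ borderClass F (productDepthEdgeClass (LaurentSeries F) (RCVars n)
      (s + (3 * n ^ 3 + 19 * n ^ 2) + 2) (Δ + 1)) := by
    have h1 : MvPolynomial.aeval (rcSubst F n ↥𝓔) C ∈ borderClass F
        (productDepthEdgeClass (LaurentSeries F) (RCVars n) (s + (3 * n ^ 3 + 19 * n ^ 2)) (Δ + 1)) :=
      aeval_rcSubst_mem_borderClass (ι := ↥𝓔) hCs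
    exact one_sub_mem_borderClass_productDepthEdgeClass h1
  have h66 := hr₀ F n (n + n) r (le_trans (le_max_left _ _) hr0) (rcResidual F n C) hfI hf0
    (Or.inl (ringChar.eq F 0)) _ hfmem
  -- exponent bookkeeping: `exp(-2cΔ) ≤ exp(-c(Δ+1))`, `log r ≥ 1`
  have hr3 : (3 : ℝ) ≤ r := by exact_mod_cast le_trans (le_max_right _ _) hr0
  have hr1 : (1 : ℝ) ≤ r := by linarith
  have hlog : 1 ≤ Real.log r := by
    rw [Real.le_log_iff_exp_le (by linarith)]
    exact le_trans (le_of_lt (lt_trans Real.exp_one_lt_d9 (by norm_num))) hr3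
  have hexp : Real.exp (-(2 * c * Δ)) ≤ Real.exp (-(c * ((Δ + 1 : ℕ) : ℝ))) := by
    rw [Real.exp_le_exp]
    push_cast
    have : (1 : ℝ) ≤ Δ := by exact_mod_cast hΔ
    nlinarith
  have hpow : (Real.log r) ^ Real.exp (-(2 * c * Δ)) ≤ (Real.log r) ^ Real.exp (-(c * ((Δ + 1 : ℕ) : ℝ))) :=
    Real.rpow_le_rpow_of_exponent_le hlog hexp
  have hn1 : 1 ≤ n := hr.trans hrn
  have h2 : (n : ℝ) ^ 2 ≤ (n : ℝ) ^ 4 := pow_le_pow_right₀ (by exact_mod_cast hn1) (by norm_num)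
  have h3 : (n : ℝ) ^ 3 ≤ (n : ℝ) ^ 4 := pow_le_pow_right₀ (by exact_mod_cast hn1) (by norm_num)
  have h4 : (1 : ℝ) ≤ (n : ℝ) ^ 4 := one_le_pow₀ (by exact_mod_cast hn1)
  calc (r : ℝ) ^ ((Real.log r) ^ Real.exp (-(2 * c * Δ)))
      ≤ (r : ℝ) ^ ((Real.log r) ^ Real.exp (-(c * ((Δ + 1 : ℕ) : ℝ)))) :=
        Real.rpow_le_rpow_of_exponent_le hr1 hpow
    _ ≤ ((s + (3 * n ^ 3 + 19 * n ^ 2) + 2 : ℕ) : ℝ) := h66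
    _ ≤ s + 28 * (n : ℝ) ^ 4 := by push_cast; linarith

/-- **Andrews–Forbes 2022, Corollary 8.4** (p0040:L46–L56; `char F = 0`): with `𝓔 ⊆ F^{r × n}` the
weak `(r, r(n-r))`-lossless rank condenser of size `|𝓔| = 2r(n-r) + 1` given by Lemma 2.12
(`𝓔 = {W_ω(α) : α ∈ S}`, `ω` of multiplicative order `≥ n`, `S ⊆ F ∖ {0}`), and `C` an IPS
refutation of `det_r(E X Eᵀ) = 0 (E ∈ 𝓔)`, `XY - I_n = 0`, `X∘X - X = 0`, `Y∘Y - Y = 0`: any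
product-depth-`Δ` circuit computing `C + O(ε)` has size `r^{(log r)^{exp(-O(Δ))}} - O(n⁴)`.
RENDERING as for Lemma 6.6 in the tree (universal `c`; threshold `r ≥ r₀` chosen after `Δ ≥ 1`;
natural `log`; `O(n⁴) ↦ 28 n⁴`); the Lemma 2.12 data are carried as printed and not used (the
bound holds for every finite `𝓔`, `AndrewsForbes2022_cor_8_4_of_finset`). PROVED.
[cite: AndrewsForbes2022, Cor. 8.4] -/
theorem AndrewsForbes2022_cor_8_4 : ∃ c : ℝ, 0 < c ∧ ∀ Δ : ℕ, 1 ≤ Δ → ∃ r₀ : ℕ,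
    ∀ (F : Type) [Field F] [CharZero F] [DecidableEq F] (n r : ℕ), r₀ ≤ r → 1 ≤ r → r ≤ n →
    ∀ (ω : F) (S : Finset F), ω ≠ 0 → (∀ k : ℕ, 0 < k → k < n → ω ^ k ≠ 1) → (0 : F) ∉ S →
      S.card = 2 * (r * (n - r)) + 1 →
    ∀ (C : MvPolynomial (RCVars n ⊕ (↥(S.image (fsCondenser F r n ω)) ⊕ RCSide n)) F),
      IsIPSCertificate F (rankCondenserSystem F n r (S.image (fsCondenser F r n ω))) C →
    ∀ s : ℕ, C ∈ borderClass F (productDepthEdgeClass (LaurentSeries F) _ s Δ) →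
      (r : ℝ) ^ ((Real.log r) ^ Real.exp (-(c * Δ))) ≤ s + 28 * (n : ℝ) ^ 4 := by
  obtain ⟨c, hc, H⟩ := AndrewsForbes2022_cor_8_4_of_finset
  refine ⟨c, hc, fun Δ hΔ => ?_⟩
  obtain ⟨r₀, hr₀⟩ := H Δ hΔ
  exact ⟨r₀, fun F _ _ _ n r hr0 hr hrn ω S _ _ _ _ C hC s hCs =>
    hr₀ F n r hr0 hr hrn (S.image (fsCondenser F r n ω)) C hC s hCs⟩

end Corollary84

/-! ### Theorem 8.6 — formula IPS refutations of the rank-condenser system -/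

section Theorem86

variable {F : Type u} [Field F]

/-- Differences: `E(p - q) ≤ E(p) + E(q) + 2` (`p - q = p + (-1) • q`).
[cite: BurgisserClausenShokrollahi1997, §21.1 p. 549] -/
theorem formulaComplexity_sub_le {σ : Type v} (p q : MvPolynomial σ F) :
    formulaComplexity (p - q) ≤ formulaComplexity p + formulaComplexity q + 2 := by
  have h : p - q = p + (-1 : F) • q := by rw [neg_one_smul, sub_eq_add_neg]
  rw [h]
  refine (formulaComplexity_add_le _ _).trans ?_
  have := formulaComplexity_smul_le (-1 : F) q
  omega

/-- Formula size of the substituted polynomials: each coordinate of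
`(X, Y, 0, XY - I_n, X∘X - X, Y∘Y - Y)` has a fan-in-two formula with `≤ 2n + 3` gates ("the
coordinates of `XY - I_n`, `X∘X - X`, `Y∘Y - Y` can each be computed by a formula of size `O(n)`",
p0041:L11; gate count). [cite: AndrewsForbes2022, Thm. 8.6 (proof)] -/
theorem formulaComplexity_rcSubst_le (n : ℕ) (ι : Type v) (m : RCVars n ⊕ (ι ⊕ RCSide n)) :
    formulaComplexity (rcSubst F n ι m) ≤ 2 * n + 3 := by
  classical
  have hXX : ∀ a b : RCVars n, formulaComplexity (X a * X b : MvPolynomial (RCVars n) F) ≤ 1 :=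
    fun a b => (formulaComplexity_mul_le _ _).trans (by
      rw [formulaComplexity_X_eq_zero, formulaComplexity_X_eq_zero])
  have hB : ∀ a : RCVars n, formulaComplexity (X a * X a - X a : MvPolynomial (RCVars n) F) ≤ 3 :=
    fun a => (formulaComplexity_sub_le _ _).trans (by
      have := hXX a a; rw [formulaComplexity_X_eq_zero]; omega)
  rcases m with v | e | ij | ij | ij
  · change formulaComplexity (X v : MvPolynomial (RCVars n) F) ≤ _
    rw [formulaComplexity_X_eq_zero]; exact Nat.zero_le _
  · change formulaComplexity (0 : MvPolynomial (RCVars n) F) ≤ _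
    rw [← C_0, formulaComplexity_C_eq_zero]; exact Nat.zero_le _
  · change formulaComplexity (rcSideEqns F n (Sum.inl ij)) ≤ _
    have hrepr : rcSideEqns F n (Sum.inl ij) =
        (∑ k : Fin n, X (ij.1, Fin.castAdd n k) * X (k, Fin.natAdd n ij.2)) -
          (1 : Matrix (Fin n) (Fin n) (MvPolynomial (RCVars n) F)) ij.1 ij.2 := by
      simp [rcSideEqns, Matrix.mul_apply, rcX, rcY]
    rw [hrepr]
    refine (formulaComplexity_sub_le _ _).trans ?_
    have h1 : formulaComplexity (∑ k : Fin n, X (ij.1, Fin.castAdd n k) * X (k, Fin.natAdd n ij.2) :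
        MvPolynomial (RCVars n) F) ≤ 2 * n := by
      refine (formulaComplexity_finset_sum_le _ _).trans ?_
      calc ∑ k : Fin n, (formulaComplexity (X (ij.1, Fin.castAdd n k) * X (k, Fin.natAdd n ij.2) :
              MvPolynomial (RCVars n) F) + 1) ≤ ∑ _k : Fin n, 2 :=
            Finset.sum_le_sum fun k _ => by have := hXX (ij.1, Fin.castAdd n k) (k, Fin.natAdd n ij.2); omega
        _ = 2 * n := by simp [mul_comm]
    have h2 : formulaComplexity ((1 : Matrix (Fin n) (Fin n) (MvPolynomial (RCVars n) F)) ij.1 ij.2) = 0 := by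
      rw [Matrix.one_apply]
      split_ifs
      · rw [← C_1, formulaComplexity_C_eq_zero]
      · rw [← C_0, formulaComplexity_C_eq_zero]
    omega
  · change formulaComplexity (rcSideEqns F n (Sum.inr (Sum.inl ij))) ≤ _
    exact (hB (ij.1, Fin.castAdd n ij.2)).trans (by omega)
  · change formulaComplexity (rcSideEqns F n (Sum.inr (Sum.inr ij))) ≤ _
    exact (hB (ij.1, Fin.natAdd n ij.2)).trans (by omega)

/-- `formulaClass` is monotone in the size bound. [cite: AndrewsForbes2022, §7 (Lemma 7.1)] -/
theorem formulaClass_mono (k : Type u) [CommSemiring k] (M : Type v) {s s' : ℕ} (h : s ≤ s') :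
    formulaClass k M s ⊆ formulaClass k M s' :=
  fun _ hf => le_trans (show formulaComplexity _ ≤ s from hf) h

/-- **The common core of Thm. 8.6** (p0041:L2–L12): from a refutation `C` computed up to `O(ε)`
by a formula with `s` gates, `f = 1 - C(X,Y,0,XY-I,X∘X-X,Y∘Y-Y)` is a nonzero element of
`I^det_{n,2n,r}` and some `Φ` with `1 - Φ = f + O(ε)` has a formula with
`≤ s + (s+1)(2n+3)` gates (substitution into the `≤ s + 1` leaves).
[cite: AndrewsForbes2022, Thm. 8.6 (proof)] -/
theorem Theorem86.prep {F : Type} [Field F] {n r : ℕ} (𝓔 : Finset (Matrix (Fin r) (Fin n) F))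
    (C : MvPolynomial (RCVars n ⊕ (↥𝓔 ⊕ RCSide n)) F)
    (hC : IsIPSCertificate F (rankCondenserSystem F n r 𝓔) C) {s : ℕ}
    (hCs : C ∈ borderClass F (formulaClass (LaurentSeries F) _ s)) :
    rcResidual F n C ≠ 0 ∧ rcResidual F n C ∈ detIdeal F n (n + n) r ∧
      ∃ Φ : MvPolynomial (RCVars n) (LaurentSeries F),
        formulaComplexity Φ ≤ s + (s + 1) * (2 * n + 3) ∧
        PolyOrdGE 1 ((1 - Φ) - MvPolynomial.map (algebraMap F (LaurentSeries F)) (rcResidual F n C)) := by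
  obtain ⟨hf0, hfI⟩ := rcResidual_ne_zero_and_mem_detIdeal 𝓔 C hC
  obtain ⟨h, hh, hord⟩ := hCs
  change formulaComplexity h ≤ s at hh
  set φ : F →+* LaurentSeries F := algebraMap F (LaurentSeries F) with hφ
  refine ⟨hf0, hfI, bind₁ (fun m => MvPolynomial.map φ (rcSubst F n ↥𝓔 m)) h, ?_, ?_⟩
  · have hB : ∀ m, formulaComplexity (MvPolynomial.map φ (rcSubst F n ↥𝓔 m)) ≤ 2 * n + 3 :=
      fun m => (formulaComplexity_map_le _ _).trans (formulaComplexity_rcSubst_le n _ m)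
    refine (formulaComplexity_bind₁_le hB h).trans ?_
    exact Nat.add_le_add hh (Nat.mul_le_mul_right _ (Nat.succ_le_succ hh))
  · have : (1 - bind₁ (fun m => MvPolynomial.map φ (rcSubst F n ↥𝓔 m)) h) -
        MvPolynomial.map φ (rcResidual F n C) =
        -(bind₁ (fun m => MvPolynomial.map φ (rcSubst F n ↥𝓔 m)) h -
          MvPolynomial.map φ (MvPolynomial.aeval (rcSubst F n ↥𝓔) C)) := by
      rw [rcResidual, map_sub, map_one]; ring
    rw [this]
    refine PolyOrdGE.neg ?_
    rw [aeval_eq_bind₁, map_bind₁, ← map_sub]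
    exact hord.bind₁ fun m => PolyOrdGE.map_algebraMap _

/-- The gate count of Thm. 8.6: `(s'' + 1)(2m² + 3) + 1 ≤ 32 (s + 1) n³` for
`s'' = s + (s+1)(2n+3)`, `1 ≤ r ≤ n`, `2m³ ≤ r`. [cite: AndrewsForbes2022, Thm. 8.6 (proof)] -/
theorem Theorem86.gates_le {n r m s : ℕ} (hr : 1 ≤ r) (hrn : r ≤ n) (hm : 2 * m ^ 3 ≤ r) :
    (s + (s + 1) * (2 * n + 3) + 1) * (2 * (m * m) + 3) + 1 ≤ 32 * (s + 1) * n ^ 3 := by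
  have hn1 : 1 ≤ n := hr.trans hrn
  have hmn : m ≤ n := by
    have : m ≤ m ^ 3 := Nat.le_self_pow (by norm_num) m
    omega
  have h1 : m * m ≤ n * n := Nat.mul_le_mul hmn hmn
  have hA : s + (s + 1) * (2 * n + 3) + 1 = (s + 1) * (2 * n + 4) := by ring
  rw [hA]
  have h2 : n ≤ n ^ 3 := by
    calc n = n * 1 := (mul_one n).symm
      _ ≤ n * n ^ 2 := Nat.mul_le_mul_left _ (Nat.one_le_pow _ _ hn1)
      _ = n ^ 3 := by ring
  have h3 : n * n ≤ n ^ 3 := by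
    calc n * n = n * n * 1 := (mul_one _).symm
      _ ≤ n * n * n := Nat.mul_le_mul_left _ hn1
      _ = n ^ 3 := by ring
  have h4 : 1 ≤ n ^ 3 := Nat.one_le_pow _ _ hn1
  have h5 : (2 * n + 4) * (2 * (m * m) + 3) ≤ 30 * n ^ 3 := by
    calc (2 * n + 4) * (2 * (m * m) + 3) ≤ (2 * n + 4) * (2 * (n * n) + 3) :=
          Nat.mul_le_mul_left _ (by omega)
      _ = 4 * (n * (n * n)) + 8 * (n * n) + 6 * n + 12 := by ring
      _ ≤ 30 * n ^ 3 := by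
          have : n * (n * n) = n ^ 3 := by ring
          rw [this]; omega
  calc (s + 1) * (2 * n + 4) * (2 * (m * m) + 3) + 1
      = (s + 1) * ((2 * n + 4) * (2 * (m * m) + 3)) + 1 := by ring
    _ ≤ (s + 1) * (30 * n ^ 3) + (s + 1) * n ^ 3 := by
        have h6 : 1 ≤ (s + 1) * n ^ 3 := by
          have := Nat.mul_le_mul (show 1 ≤ s + 1 by omega) h4
          simpa using this
        exact Nat.add_le_add (Nat.mul_le_mul_left _ h5) h6
    _ ≤ 32 * (s + 1) * n ^ 3 := by nlinarith

/-- **Thm. 8.6, the reduction (characteristic `0`)**: let `C` be an IPS refutation of the system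
(`1 ≤ r ≤ n`, any finite `𝓔 ⊆ F^{r × n}`). If a formula with `s` gates computes `C + O(ε)`, then for
every `m` with `2m³ ≤ r` a formula with `≤ 32 (s+1) n³` gates computes `det_m + O(ε)` (proof of
Thm. 8.6, p0041:L2–L19: "a formula of size `O(sn)` computes `f + O(ε)`", then Cor. 3.9 for
formulas, "a formula `Φ` of size `O(sn³)`"). [cite: AndrewsForbes2022, Thm. 8.6 (proof)] -/
theorem AndrewsForbes2022_thm_8_6_formula (F : Type) [Field F] [CharZero F] {n r : ℕ}
    (hr : 1 ≤ r) (hrn : r ≤ n) (𝓔 : Finset (Matrix (Fin r) (Fin n) F))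
    (C : MvPolynomial (RCVars n ⊕ (↥𝓔 ⊕ RCSide n)) F)
    (hC : IsIPSCertificate F (rankCondenserSystem F n r 𝓔) C) {s : ℕ}
    (hCs : C ∈ borderClass F (formulaClass (LaurentSeries F) _ s))
    {m : ℕ} (hm : 2 * m ^ 3 ≤ r) :
    detPoly (Fin m) F ∈ borderClass F
      (formulaClass (LaurentSeries F) (Fin m × Fin m) (32 * (s + 1) * n ^ 3)) := by
  classical
  obtain ⟨hf0, hfI, Φ, hΦ, hord⟩ := Theorem86.prep 𝓔 C hC hCs
  rcases Nat.eq_zero_or_pos m with rfl | hmpos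
  · have h1 : detPoly (Fin 0) F = MvPolynomial.C 1 := by simp [detPoly]
    rw [h1]
    refine mem_borderClass_of_mem ?_
    change formulaComplexity _ ≤ _
    rw [map_C, formulaComplexity_C_eq_zero]; exact Nat.zero_le _
  · have habp : InLayeredABPBorder r (detPoly (Fin m) F) :=
      InLayeredABPBorder.of_computes
        ((Corollary39.layeredABPComputes_detPoly_cubic m hmpos).mono hm)
    have h38 := AndrewsForbes2022_thm_3_8_holds F n (n + n) r (rcResidual F n C) hfI hf0 (1 - Φ)
      hord (Fin m × Fin m) (detPoly (Fin m) F) habp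
    have hmem := DepthThreeOracleComputes.mem_borderClass_formulaClass h38.of_one_sub hΦ
    refine borderClass_mono (formulaClass_mono _ _ ?_) hmem
    simp only [Fintype.card_prod, Fintype.card_fin]
    exact Theorem86.gates_le hr hrn hm

/-- **Thm. 8.6, the reduction (characteristic `p > 0`)**: as `AndrewsForbes2022_thm_8_6_formula`,
a formula with `≤ 32 (s+1) n³` gates computing `det_m^{p^e} + O(ε)` for some `e`.
[cite: AndrewsForbes2022, Thm. 8.6 (proof)] -/
theorem AndrewsForbes2022_thm_8_6_formula_posChar (p : ℕ) [Fact p.Prime] (F : Type) [Field F]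
    [CharP F p] {n r : ℕ} (hr : 1 ≤ r) (hrn : r ≤ n) (𝓔 : Finset (Matrix (Fin r) (Fin n) F))
    (C : MvPolynomial (RCVars n ⊕ (↥𝓔 ⊕ RCSide n)) F)
    (hC : IsIPSCertificate F (rankCondenserSystem F n r 𝓔) C) {s : ℕ}
    (hCs : C ∈ borderClass F (formulaClass (LaurentSeries F) _ s))
    {m : ℕ} (hm : 2 * m ^ 3 ≤ r) :
    ∃ e : ℕ, detPoly (Fin m) F ^ p ^ e ∈ borderClass F
      (formulaClass (LaurentSeries F) (Fin m × Fin m) (32 * (s + 1) * n ^ 3)) := by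
  classical
  obtain ⟨hf0, hfI, Φ, hΦ, hord⟩ := Theorem86.prep 𝓔 C hC hCs
  rcases Nat.eq_zero_or_pos m with rfl | hmpos
  · refine ⟨0, ?_⟩
    have h1 : detPoly (Fin 0) F ^ p ^ 0 = MvPolynomial.C 1 := by simp [detPoly]
    rw [h1]
    refine mem_borderClass_of_mem ?_
    change formulaComplexity _ ≤ _
    rw [map_C, formulaComplexity_C_eq_zero]; exact Nat.zero_le _
  · have habp : InLayeredABPBorder r (detPoly (Fin m) F) :=
      InLayeredABPBorder.of_computes
        ((Corollary39.layeredABPComputes_detPoly_cubic m hmpos).mono hm)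
    obtain ⟨e, h38⟩ := AndrewsForbes2022_thm_3_8_posChar_holds p F n (n + n) r (rcResidual F n C)
      hfI hf0 (1 - Φ) hord (Fin m × Fin m) (detPoly (Fin m) F) habp
    have hmem := DepthThreeOracleComputes.mem_borderClass_formulaClass h38.of_one_sub hΦ
    refine ⟨e, borderClass_mono (formulaClass_mono _ _ ?_) hmem⟩
    simp only [Fintype.card_prod, Fintype.card_fin]
    exact Theorem86.gates_le hr hrn hm

/-- **Thm. 8.6 for every finite `𝓔`, with the printed lower-bound function `t`**: if every
(border) formula for `det_m` (char `0`) / for each `det_m^{p^k}` (char `p`) has `≥ t(m)` gates,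
then a formula with `s` gates computing a refutation `C + O(ε)` forces `t(m) ≤ 32 (s+1) n³` for
all `m` with `2m³ ≤ r` — i.e. `s ≥ Ω(t(Ω(r^{1/3})) / n³)`. [cite: AndrewsForbes2022, Thm. 8.6] -/
theorem AndrewsForbes2022_thm_8_6_of_finset (F : Type) [Field F] {n r : ℕ} (hr : 1 ≤ r)
    (hrn : r ≤ n) (𝓔 : Finset (Matrix (Fin r) (Fin n) F)) (t : ℕ → ℕ)
    (ht0 : ringChar F = 0 → ∀ (m s : ℕ), detPoly (Fin m) F ∈
      borderClass F (formulaClass (LaurentSeries F) (Fin m × Fin m) s) → t m ≤ s)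
    (htp : ∀ p : ℕ, p.Prime → ringChar F = p → ∀ (m k s : ℕ), detPoly (Fin m) F ^ p ^ k ∈
      borderClass F (formulaClass (LaurentSeries F) (Fin m × Fin m) s) → t m ≤ s)
    (C : MvPolynomial (RCVars n ⊕ (↥𝓔 ⊕ RCSide n)) F)
    (hC : IsIPSCertificate F (rankCondenserSystem F n r 𝓔) C) {s : ℕ}
    (hCs : C ∈ borderClass F (formulaClass (LaurentSeries F) _ s))
    {m : ℕ} (hm : 2 * m ^ 3 ≤ r) : t m ≤ 32 * (s + 1) * n ^ 3 := by
  obtain ⟨p, hp⟩ := CharP.exists F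
  rcases CharP.char_is_prime_or_zero F p with hpp | rfl
  · haveI : Fact p.Prime := ⟨hpp⟩
    obtain ⟨e, he⟩ := AndrewsForbes2022_thm_8_6_formula_posChar p F hr hrn 𝓔 C hC hCs hm
    exact htp p hpp (ringChar.eq F p) m e _ he
  · haveI : CharZero F := CharP.charP_to_charZero F
    exact ht0 (ringChar.eq F 0) m _ (AndrewsForbes2022_thm_8_6_formula F hr hrn 𝓔 C hC hCs hm)

/-- **Andrews–Forbes 2022, Theorem 8.6** (p0040:L78–p0041:L19). Let `X, Y` be `n × n` matrices of
variables, `r ≤ n` (`1 ≤ r`), `𝓔 ⊆ F^{r × n}` the weak `(r, r(n-r))`-lossless rank condenser of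
size `|𝓔| = 2r(n-r)+1` given by Lemma 2.12 (`{W_ω(α) : α ∈ S}`).  Assume: if `char F = 0`, any
formula computing `det_n(X) + O(ε)` has size `≥ t(n)`; if `char F = p > 0`, any formula
computing `det_n(X)^{p^k} + O(ε)`, any `k`, has size `≥ t(n)`.  Let `C(X,Y,z⃗,W,U,V)` be an IPS
refutation of `det_r(E X Eᵀ) = 0 (E ∈ 𝓔)`, `XY - I_n = 0`, `X∘X - X = 0`, `Y∘Y - Y = 0`.  Then any
formula computing `C + O(ε)` has size `Ω(t(Ω(r^{1/3})) / n³)`.  RENDERING: formula size =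
fan-in-two gate count (`formulaClass`; print counts leaves); conclusion `t(m) ≤ 32 (s+1) n³` for
every `m` with `2m³ ≤ r`; the Lemma 2.12 data are carried as printed and not used
(`AndrewsForbes2022_thm_8_6_of_finset` holds for every finite `𝓔`). PROVED.
[cite: AndrewsForbes2022, Thm. 8.6] -/
theorem AndrewsForbes2022_thm_8_6 (F : Type) [Field F] [DecidableEq F] {n r : ℕ} (hr : 1 ≤ r)
    (hrn : r ≤ n) (ω : F) (S : Finset F) (_hω0 : ω ≠ 0)
    (_hω : ∀ k : ℕ, 0 < k → k < n → ω ^ k ≠ 1) (_hS : (0 : F) ∉ S)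
    (_hcard : S.card = 2 * (r * (n - r)) + 1) (t : ℕ → ℕ)
    (ht0 : ringChar F = 0 → ∀ (m s : ℕ), detPoly (Fin m) F ∈
      borderClass F (formulaClass (LaurentSeries F) (Fin m × Fin m) s) → t m ≤ s)
    (htp : ∀ p : ℕ, p.Prime → ringChar F = p → ∀ (m k s : ℕ), detPoly (Fin m) F ^ p ^ k ∈
      borderClass F (formulaClass (LaurentSeries F) (Fin m × Fin m) s) → t m ≤ s)
    (C : MvPolynomial (RCVars n ⊕ (↥(S.image (fsCondenser F r n ω)) ⊕ RCSide n)) F)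
    (hC : IsIPSCertificate F (rankCondenserSystem F n r (S.image (fsCondenser F r n ω))) C) {s : ℕ}
    (hCs : C ∈ borderClass F (formulaClass (LaurentSeries F) _ s))
    {m : ℕ} (hm : 2 * m ^ 3 ≤ r) : t m ≤ 32 * (s + 1) * n ^ 3 :=
  AndrewsForbes2022_thm_8_6_of_finset F hr hrn _ t ht0 htp C hC hCs hm

end Theorem86

end Literature.Computability.AlgebraicComplexity
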